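import Summits.Ventures.YMGap.RobustBall.EnergyVarianceDLRKernel
import Summits.Ventures.YMGap.RobustBall.PlaquetteFirstMomentResample
import HarnessLib

/-!
# Robust ball (Y2), strong-coupling laws — the inverse Efron–Stein inequality for DLR STATES on `ℤ^d`, II: an extensive floor for the
# energy variance of EVERY DLR state at EVERY coupling

HONEST FRAMING: venture file of the cell `pub-ymgap` (QuantumFields programme), track ROBUST-BALL, seat rb-p2 (g8).  LATTICE statement about the
DLR states `μ ∈ ymGibbsMeasures ρ β` of Wilson's lattice gauge theory on `ℤ^d` for a special unitary model `ρ` (`G ≅ SU(N)`, `N ≥ 2`, `d ≥ 2`),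
at EVERY real `β`, for EVERY DLR state (unique or not, invariant or not).  It is the lower companion of ds-1's extensive UPPER bound
`PlaquetteEnergyVariance.variance_sum_plaquette_le_of_massGapAt` (inside the mass-gap window): energy fluctuations are non-degenerate and extensive.
Nothing about the continuum, a spectral gap or Clay.

THE THEOREM (`card_mul_le_variance_plaquetteSum`).  Let `F` be a finite set of links of `ℤ^d` no two of which lie on a common plaquette, and `P` a
finite set of plaquettes containing every plaquette through a link of `F`.  Then for every DLR state `μ` at coupling `β`

  `|F| · e^{−8(d−1)N|β|} · V₀ ≤ Var_μ(Σ_{p ∈ P} Re tr ρ(U_p))`,   `V₀ = charVariance ρ`.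

MECHANISM: the inverse Efron–Stein inequality `EnergyVarianceBessel.sum_dirichlet_le_variance` for the one-link kernels of the Wilson specification
(`EnergyVarianceDLRKernel`: Markov, finite range, DLR-invariance, density floor `e^{−4(d−1)N|β|}`), the separability of the plaquette sum across
separated links, and — for the mean Haar fibre variance at a link `e` — rb-p2 g6's private-link resampling on `ℤ^d` (`exists_resampling_link`,
`staple_update_eq_of_ne`: resampling the private link `f` of one plaquette `p₀ ∋ e` turns its staple into `a·h'·b` and leaves the other staples at
`e` alone), which restores one full character variance `V₀` (`integral_add_reTr_sq`): `charVariance_le_integral_fibreVariance_zd`.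

References: H.-O. Georgii (2011), Remark 1.24; E. Seiler, LNP 159 (1982), Ch. 2.  Everything here is proved. [folklore]
-/

noncomputable section

open MeasureTheory ProbabilityTheory Finset Function
open Literature.MathematicalPhysics.QuantumFieldTheory.Balaban1983to89.T4DobrushinTensorisation
open Literature.MathematicalPhysics.QuantumFieldTheory.Balaban1983to89.T4CouplingChain (integrable_of_abs_le_const)
open Literature.Probability.LatticeModels Literature.Probability.LatticeModels.DobrushinMetric
open Literature.MathematicalPhysics.QuantumLattice Literature.MathematicalPhysics.QuantumFieldTheory

namespace Summit.Ventures.YMGap.RobustBall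

namespace EnergyVariance

variable {d N : ℕ} {G : Type*} [Group G] [TopologicalSpace G] [IsTopologicalGroup G] [CompactSpace G]
  [MeasurableSpace G] [BorelSpace G] [SecondCountableTopology G] [T2Space G] (ρ : G →* Matrix (Fin N) (Fin N) ℂ)

/-! ### The plaquette sum: boundedness, separability across separated links -/

omit [TopologicalSpace G] [IsTopologicalGroup G] [CompactSpace G] [MeasurableSpace G] [BorelSpace G] [SecondCountableTopology G]
  [T2Space G] in
/-- Updating a link not on the plaquette does not change the plaquette observable. [folklore] -/
theorem plaquetteObs_update_of_not_mem {p : ZdPlaquette d} {e : Literature.MathematicalPhysics.QuantumLattice.ZdEdge d}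
    (he : e ∉ plaquetteEdges p) (U : LGConfig d G) (g : G) :
    plaquetteObs ρ p.1 p.2.1.1 p.2.1.2 (update U e g) = plaquetteObs ρ p.1 p.2.1.1 p.2.1.2 U :=
  isCylinder_plaquetteObs ρ p fun z hz => by
    rw [update_of_ne]
    rintro rfl
    exact he hz

omit [TopologicalSpace G] [IsTopologicalGroup G] [CompactSpace G] [MeasurableSpace G] [BorelSpace G] [SecondCountableTopology G]
  [T2Space G] in
/-- **Additive separability of the plaquette sum in two links on no common plaquette.** [folklore] -/
theorem plaquetteSum_update_update_sub (P : Finset (ZdPlaquette d)) {e e' : Literature.MathematicalPhysics.QuantumLattice.ZdEdge d}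
    (h : ∀ p : ZdPlaquette d, e ∈ plaquetteEdges p → e' ∉ plaquetteEdges p) (U : LGConfig d G) (y z : G) :
    (∑ p ∈ P, plaquetteObs ρ p.1 p.2.1.1 p.2.1.2 (update (update U e' y) e z)) -
        ∑ p ∈ P, plaquetteObs ρ p.1 p.2.1.1 p.2.1.2 (update U e z) =
      (∑ p ∈ P, plaquetteObs ρ p.1 p.2.1.1 p.2.1.2 (update U e' y)) - ∑ p ∈ P, plaquetteObs ρ p.1 p.2.1.1 p.2.1.2 U := by
  classical
  rw [← Finset.sum_sub_distrib, ← Finset.sum_sub_distrib]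
  refine Finset.sum_congr rfl fun p _ => ?_
  by_cases hp : e ∈ plaquetteEdges p
  · have he' : e' ∉ plaquetteEdges p := h p hp
    have hne : e' ≠ e := by rintro rfl; exact he' hp
    rw [update_comm hne, plaquetteObs_update_of_not_mem ρ he', plaquetteObs_update_of_not_mem ρ he', sub_self, sub_self]
  · rw [plaquetteObs_update_of_not_mem ρ hp, plaquetteObs_update_of_not_mem ρ hp]

omit [CompactSpace G] [MeasurableSpace G] [BorelSpace G] [SecondCountableTopology G] [T2Space G] in
/-- The plaquette sum is continuous, and bounded by `#P · N` for unitary `ρ`. [folklore] -/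
theorem continuous_plaquetteSum_and_abs_le (hρ : Continuous ρ) (hρu : ∀ g, ρ g ∈ Matrix.unitaryGroup (Fin N) ℂ)
    (P : Finset (ZdPlaquette d)) :
    Continuous (fun U : LGConfig d G => ∑ p ∈ P, plaquetteObs ρ p.1 p.2.1.1 p.2.1.2 U) ∧
      ∀ U : LGConfig d G, |∑ p ∈ P, plaquetteObs ρ p.1 p.2.1.1 p.2.1.2 U| ≤ P.card * N := by
  refine ⟨continuous_finsetSum _ fun p _ => continuous_plaquetteObs ρ hρ _ _ _, fun U => ?_⟩
  calc |∑ p ∈ P, plaquetteObs ρ p.1 p.2.1.1 p.2.1.2 U| ≤ ∑ p ∈ P, |plaquetteObs ρ p.1 p.2.1.1 p.2.1.2 U| :=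
        Finset.abs_sum_le_sum_abs _ _
    _ ≤ ∑ _p ∈ P, (N : ℝ) := Finset.sum_le_sum fun p _ => abs_re_trace_le_of_mem_unitaryGroup (hρu _)
    _ = P.card * N := by rw [Finset.sum_const, nsmul_eq_mul]

/-! ### Resampling the private link restores the character variance (the `ℤ^d` fibre computation) -/

omit [T2Space G] in
/-- ★ **The mean Haar fibre variance after resampling a private link is at least `V₀`** (`ℤ^d` version of
`EnergyVarianceTorus.charVariance_le_integral_fibreVariance`).  `G ≅ SU(N)`, `N ≥ 2`; `P ⊇` the plaquettes through `e`; `p₀ ∋ e`; `f ≠ e` a link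
of `p₀` in which the staple of `p₀` at `e` is `a·h'·b`.  Then for every configuration `U`,
`V₀ ≤ ∫ Var_{Haar}(h ↦ Σ_{p∈P} Re tr ρ(U^{f←h', e←h}_p)) dh'`. [folklore] -/
theorem charVariance_le_integral_fibreVariance_zd (hρ : IsSpecialUnitaryModel ρ) (hN : 2 ≤ N) {P : Finset (ZdPlaquette d)}
    {e f : Literature.MathematicalPhysics.QuantumLattice.ZdEdge d} (hP : plaquettesTouching {e} ⊆ P) {p₀ : ZdPlaquette d}
    (he : e ∈ plaquetteEdges p₀) (hf : f ∈ plaquetteEdges p₀) (hfe : f ≠ e)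
    (hstaple : ∀ ω : LGConfig d G, ∃ a b : G, ∀ h : G, staple p₀ e (update ω f h) = a * h * b) (U : LGConfig d G) :
    PlaquetteLowerBound.charVariance ρ ≤
      ∫ h', (∫ h, ((∑ p ∈ P, plaquetteObs ρ p.1 p.2.1.1 p.2.1.2 (update (update U f h') e h)) -
          ∫ z, ∑ p ∈ P, plaquetteObs ρ p.1 p.2.1.1 p.2.1.2 (update (update U f h') e z) ∂haarProbability G) ^ 2 ∂haarProbability G)
        ∂haarProbability G := by
  classical
  have hρc : Continuous ρ := hρ.1
  have hρu := IsSpecialUnitaryModel.mem_unitaryGroup ρ hρ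
  obtain ⟨a, b, hab⟩ := hstaple U
  have hp₀ : p₀ ∈ plaquettesTouching {e} := mem_plaquettesTouching_singleton.2 he
  have hp₀P : p₀ ∈ P := hP hp₀
  set T := plaquettesTouching {e} with hT
  -- the pieces
  set R : G → ℝ := fun h => ∑ q ∈ T.erase p₀, (ρ h * ρ (staple q e U)).trace.re with hR
  set C : G → ℝ := fun h' => ∑ q ∈ P \ T, plaquetteObs ρ q.1 q.2.1.1 q.2.1.2 (update U f h') with hC
  -- the decomposition `Σ_P W(U^{f←h', e←h}) = Re tr ρ(h a h' b) + R h + C h'`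
  have hdecomp : ∀ h h', ∑ p ∈ P, plaquetteObs ρ p.1 p.2.1.1 p.2.1.2 (update (update U f h') e h) =
      (ρ (h * (a * h' * b))).trace.re + R h + C h' := by
    intro h h'
    rw [← Finset.sum_sdiff hP, ← Finset.add_sum_erase _ _ hp₀]
    have h1 : plaquetteObs ρ p₀.1 p₀.2.1.1 p₀.2.1.2 (update (update U f h') e h) = (ρ (h * (a * h' * b))).trace.re := by
      simp only [plaquetteObs]
      rw [re_trace_holonomy_update ρ hρu he, hab h', ← map_mul]
    have h2 : ∀ q ∈ T.erase p₀, plaquetteObs ρ q.1 q.2.1.1 q.2.1.2 (update (update U f h') e h) = (ρ h * ρ (staple q e U)).trace.re := by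
      intro q hq
      obtain ⟨hqp, hqT⟩ := Finset.mem_erase.1 hq
      have heq : e ∈ plaquetteEdges q := mem_plaquettesTouching_singleton.1 hqT
      simp only [plaquetteObs]
      rw [re_trace_holonomy_update ρ hρu heq, PlaquetteFirstMoment.staple_update_eq_of_ne he hf hfe heq hqp]
    have h3 : ∀ q ∈ P \ T, plaquetteObs ρ q.1 q.2.1.1 q.2.1.2 (update (update U f h') e h) =
        plaquetteObs ρ q.1 q.2.1.1 q.2.1.2 (update U f h') := by
      intro q hq
      have hqT : e ∉ plaquetteEdges q := fun h => (Finset.mem_sdiff.1 hq).2 (mem_plaquettesTouching_singleton.2 h)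
      exact plaquetteObs_update_of_not_mem ρ hqT _ _
    rw [h1, Finset.sum_congr rfl h2, Finset.sum_congr rfl h3]
    ring
  -- continuity
  have hRc : Continuous R := by
    simp only [hR]
    refine continuous_finsetSum _ fun q _ => ?_
    simp_rw [← map_mul]
    exact (continuous_trace_re ρ hρc).comp (continuous_id.mul continuous_const)
  set Rbar : ℝ := ∫ h, R h ∂haarProbability G with hRbar
  -- the fibre mean in `h`
  have hmean : ∀ h', ∫ z, ∑ p ∈ P, plaquetteObs ρ p.1 p.2.1.1 p.2.1.2 (update (update U f h') e z) ∂haarProbability G =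
      Rbar + C h' := by
    intro h'
    simp_rw [hdecomp]
    have hiX : Integrable (fun z : G => (ρ (z * (a * h' * b))).trace.re) (haarProbability G) :=
      ((continuous_trace_re ρ hρc).comp (continuous_id.mul continuous_const)).integrable_of_hasCompactSupport
        (HasCompactSupport.of_compactSpace _)
    have hi2 : Integrable R (haarProbability G) := hRc.integrable_of_hasCompactSupport (HasCompactSupport.of_compactSpace _)
    have hi12 : Integrable (fun z : G => (ρ (z * (a * h' * b))).trace.re + R z) (haarProbability G) := hiX.add hi2
    have h0 : ∫ z : G, (ρ (z * (a * h' * b))).trace.re ∂haarProbability G = 0 := by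
      have := PlaquettePositivity.integral_reTr_mul_mul_eq_zero ρ hρ hN 1 (a * h' * b)
      simp_rw [one_mul] at this
      exact this
    rw [integral_add hi12 (integrable_const _), integral_add hiX hi2, integral_const, h0, hRbar]
    simp only [smul_eq_mul, probReal_univ, one_mul, zero_add]
  -- rewrite the integrand: `T − mean = −(R h − Rbar)·(−1)… = (−(Rbar − R h)) + Re tr ρ((b h a) · h' · 1)`
  have hcyc : ∀ h h' : G, (ρ (h * (a * h' * b))).trace.re = (ρ ((b * h * a) * h' * 1)).trace.re := by
    intro h h'
    rw [mul_one, show h * (a * h' * b) = (h * a * h') * b by group, re_trace_map_mul_comm ρ (h * a * h') b]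
    congr 2
    group
  have hpt : ∀ h h', ((∑ p ∈ P, plaquetteObs ρ p.1 p.2.1.1 p.2.1.2 (update (update U f h') e h)) -
      ∫ z, ∑ p ∈ P, plaquetteObs ρ p.1 p.2.1.1 p.2.1.2 (update (update U f h') e z) ∂haarProbability G) ^ 2 =
      ((R h - Rbar) + (ρ ((b * h * a) * h' * 1)).trace.re) ^ 2 := by
    intro h h'
    rw [hmean h', hdecomp h h', hcyc]
    ring
  simp_rw [hpt]
  have hFc : Continuous fun p : G × G => ((R p.2 - Rbar) + (ρ ((b * p.2 * a) * p.1 * 1)).trace.re) ^ 2 :=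
    (((hRc.comp continuous_snd).sub continuous_const).add ((continuous_trace_re ρ hρc).comp
      ((((continuous_const.mul continuous_snd).mul continuous_const).mul continuous_fst).mul continuous_const))).pow 2
  have hFi : Integrable (uncurry fun h' h : G => ((R h - Rbar) + (ρ ((b * h * a) * h' * 1)).trace.re) ^ 2)
      ((haarProbability G).prod (haarProbability G)) :=
    hFc.integrable_of_hasCompactSupport (HasCompactSupport.of_compactSpace _)
  rw [integral_integral_swap hFi]
  have hinner : ∀ h : G, ∫ h', ((R h - Rbar) + (ρ ((b * h * a) * h' * 1)).trace.re) ^ 2 ∂haarProbability G =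
      (R h - Rbar) ^ 2 + PlaquetteLowerBound.charVariance ρ := fun h =>
    PlaquettePositivity.integral_add_reTr_sq ρ hρ hN _ (b * h * a) 1
  simp_rw [hinner]
  have hi : Integrable (fun h : G => (R h - Rbar) ^ 2) (haarProbability G) :=
    ((hRc.sub continuous_const).pow 2).integrable_of_hasCompactSupport (HasCompactSupport.of_compactSpace _)
  rw [integral_add hi (integrable_const _), integral_const, smul_eq_mul, probReal_univ, one_mul]
  have hnn : 0 ≤ ∫ h : G, (R h - Rbar) ^ 2 ∂haarProbability G := integral_nonneg fun h => sq_nonneg _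
  linarith

/-! ### The extensive energy-variance floor for every DLR state -/

/-- ★★ **EXTENSIVE FLOOR FOR THE ENERGY VARIANCE OF EVERY DLR STATE, at every coupling.**  `G ≅ SU(N)` (`N ≥ 2`), `d ≥ 2`, `β ∈ ℝ`, `μ` ANY
DLR state of the Wilson specification at `β`; `F` a finite set of links no two on a common plaquette; `P` a finite set of plaquettes containing all
plaquettes through links of `F`.  Then

  `|F| · e^{−8(d−1)N|β|} · V₀ ≤ ∫ (Σ_{p∈P} Re tr ρ(U_p) − ⟨Σ_{p∈P} Re tr ρ(U_p)⟩_μ)² dμ`. [folklore] -/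
theorem card_mul_le_variance_plaquetteSum (hρ : IsSpecialUnitaryModel ρ) (hN : 2 ≤ N) (hd : 2 ≤ d) {β : ℝ}
    {μ : Measure (LGConfig d G)} (hμ : μ ∈ ymGibbsMeasures ρ β) (F : Finset (Literature.MathematicalPhysics.QuantumLattice.ZdEdge d))
    (hF : ∀ e ∈ F, ∀ e' ∈ F, e ≠ e' → ∀ p : ZdPlaquette d, e ∈ plaquetteEdges p → e' ∉ plaquetteEdges p)
    (P : Finset (ZdPlaquette d)) (hP : ∀ e ∈ F, plaquettesTouching {e} ⊆ P) :
    (F.card : ℝ) * Real.exp (-(8 * (d - 1 : ℕ) * N * |β|)) * PlaquetteLowerBound.charVariance ρ ≤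
      ∫ U, ((∑ p ∈ P, plaquetteObs ρ p.1 p.2.1.1 p.2.1.2 U) - ∫ V, ∑ p ∈ P, plaquetteObs ρ p.1 p.2.1.1 p.2.1.2 V ∂μ) ^ 2 ∂μ := by
  classical
  have hρc : Continuous ρ := hρ.1
  have hρu := IsSpecialUnitaryModel.mem_unitaryGroup ρ hρ
  haveI := hμ.isProbabilityMeasure
  set D : ℝ := 4 * (d - 1 : ℕ) * N * |β| with hD
  -- the one-link kernels
  set q : (e : Literature.MathematicalPhysics.QuantumLattice.ZdEdge d) → Kernel (LGConfig d G) G := fun e =>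
    ⟨fun U : LGConfig d G => siteLaw (ymSpecification ρ β) e U, measurable_siteLaw_ymSpecification ρ hρc β e⟩ with hq
  have hqapp : ∀ e U, q e U = siteLaw (ymSpecification ρ β) e U := fun e U => rfl
  haveI : ∀ e, IsMarkovKernel (q e) := fun e => isMarkovKernel_siteLaw_ymSpecification ρ hρc β e
  have hloc : ∀ (e : Literature.MathematicalPhysics.QuantumLattice.ZdEdge d) (U : LGConfig d G) (y : G), q e (update U e y) = q e U :=
    fun e U y => by rw [hqapp, hqapp]; exact siteLaw_ymSpecification_update_of_separated ρ hρc β (Or.inl rfl) U y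
  have hinv : ResamplingInvariant μ q := resamplingInvariant_of_mem_ymGibbsMeasures ρ hρc hμ
  have hfloor : ∀ (e : Literature.MathematicalPhysics.QuantumLattice.ZdEdge d) (U : LGConfig d G) (g : G → ℝ) (B : ℝ), Measurable g →
      (∀ y, 0 ≤ g y) → (∀ y, |g y| ≤ B) → Real.exp (-D) * ∫ y, g y ∂haarProbability G ≤ ∫ y, g y ∂(q e U) :=
    fun e U g B hgm hg0 hgB => by
      rw [hqapp]; exact exp_neg_mul_integral_haar_le_integral_siteLaw ρ hρc hρu β e U hgm hg0 hgB
  -- the observable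
  obtain ⟨hfc, hfb⟩ := continuous_plaquetteSum_and_abs_le (d := d) ρ hρc hρu P
  have hfm : Measurable fun U : LGConfig d G => ∑ p ∈ P, plaquetteObs ρ p.1 p.2.1.1 p.2.1.2 U := hfc.measurable
  -- Step 1: inverse Efron–Stein
  have h1 := sum_dirichlet_le_variance hloc hinv hfm hfb F
    (fun e he e' he' hne U y z => plaquetteSum_update_update_sub ρ P (hF e he e' he' hne) U y z)
    (fun e he e' he' hne U y => by
      rw [hqapp, hqapp]
      exact siteLaw_ymSpecification_update_of_separated ρ hρc β (Or.inr (hF e he e' he' hne)) U y)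
  -- Step 2: Dirichlet form ≥ e^{−D} · mean Haar fibre variance ≥ e^{−D} · e^{−D} · V₀
  have h2 : ∀ e ∈ F, Real.exp (-D) * (Real.exp (-D) * PlaquetteLowerBound.charVariance ρ) ≤
      ∫ U, (∑ p ∈ P, plaquetteObs ρ p.1 p.2.1.1 p.2.1.2 U) *
        ((∑ p ∈ P, plaquetteObs ρ p.1 p.2.1.1 p.2.1.2 U) - resample q e (fun U => ∑ p ∈ P, plaquetteObs ρ p.1 p.2.1.1 p.2.1.2 U) U) ∂μ := by
    intro e he
    refine le_trans (mul_le_mul_of_nonneg_left ?_ (Real.exp_pos _).le)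
      (dirichlet_ge_exp_neg_mul_fibreVariance_of_floor hloc hinv e (haarProbability G) (hfloor e) hfm hfb)
    -- a plaquette through `e` and its private link
    obtain ⟨p₀, hp₀⟩ : (plaquettesTouching {e}).Nonempty := by
      obtain ⟨j, hj⟩ : ∃ j : Fin d, j ≠ e.2 := by
        by_cases h0 : e.2 = ⟨0, by omega⟩
        · exact ⟨⟨1, by omega⟩, fun h => by rw [h0] at h; exact absurd (congrArg Fin.val h) (by norm_num)⟩
        · exact ⟨⟨0, by omega⟩, fun h => h0 h.symm⟩
      rcases lt_or_gt_of_ne hj with hlt | hgt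
      · refine ⟨(e.1, ⟨(j, e.2), hlt⟩), mem_plaquettesTouching_singleton.2 ?_⟩
        rw [plaquetteEdges_eq]; simp [plaqLink4]
      · refine ⟨(e.1, ⟨(e.2, j), hgt⟩), mem_plaquettesTouching_singleton.2 ?_⟩
        rw [plaquetteEdges_eq]; simp [plaqLink1]
    have he₀ : e ∈ plaquetteEdges p₀ := mem_plaquettesTouching_singleton.1 hp₀
    obtain ⟨f, hf, hfe, hstaple⟩ := PlaquetteFirstMoment.exists_resampling_link (G := G) p₀ he₀
    -- the fibre variance functional: measurable, bounded, non-negative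
    set B : ℝ := P.card * N with hB
    have hj : Measurable fun pr : LGConfig d G × G => ∑ p ∈ P, plaquetteObs ρ p.1 p.2.1.1 p.2.1.2 (update pr.1 e pr.2) :=
      hfm.comp measurable_update'
    have hM : Measurable fun U : LGConfig d G => ∫ z, ∑ p ∈ P, plaquetteObs ρ p.1 p.2.1.1 p.2.1.2 (update U e z) ∂haarProbability G :=
      (hj.stronglyMeasurable.integral_prod_right' (ν := haarProbability G)).measurable
    have hsq : Measurable fun pr : LGConfig d G × G => ((∑ p ∈ P, plaquetteObs ρ p.1 p.2.1.1 p.2.1.2 (update pr.1 e pr.2)) -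
        ∫ z, ∑ p ∈ P, plaquetteObs ρ p.1 p.2.1.1 p.2.1.2 (update pr.1 e z) ∂haarProbability G) ^ 2 :=
      (hj.sub (hM.comp measurable_fst)).pow_const 2
    have hgm : Measurable fun U : LGConfig d G => ∫ h, ((∑ p ∈ P, plaquetteObs ρ p.1 p.2.1.1 p.2.1.2 (update U e h)) -
        ∫ z, ∑ p ∈ P, plaquetteObs ρ p.1 p.2.1.1 p.2.1.2 (update U e z) ∂haarProbability G) ^ 2 ∂haarProbability G :=
      (hsq.stronglyMeasurable.integral_prod_right' (ν := haarProbability G)).measurable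
    have hg0 : ∀ U : LGConfig d G, 0 ≤ ∫ h, ((∑ p ∈ P, plaquetteObs ρ p.1 p.2.1.1 p.2.1.2 (update U e h)) -
        ∫ z, ∑ p ∈ P, plaquetteObs ρ p.1 p.2.1.1 p.2.1.2 (update U e z) ∂haarProbability G) ^ 2 ∂haarProbability G :=
      fun U => integral_nonneg fun h => sq_nonneg _
    have hgB : ∀ U : LGConfig d G, |∫ h, ((∑ p ∈ P, plaquetteObs ρ p.1 p.2.1.1 p.2.1.2 (update U e h)) -
        ∫ z, ∑ p ∈ P, plaquetteObs ρ p.1 p.2.1.1 p.2.1.2 (update U e z) ∂haarProbability G) ^ 2 ∂haarProbability G| ≤ (B + B) ^ 2 := by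
      intro U
      have hMb : |∫ z, ∑ p ∈ P, plaquetteObs ρ p.1 p.2.1.1 p.2.1.2 (update U e z) ∂haarProbability G| ≤ B :=
        abs_integral_le_of_abs_le _ fun z => hfb _
      exact abs_integral_le_of_abs_le _ fun h => by
        rw [abs_pow]; exact pow_le_pow_left₀ (abs_nonneg _) ((abs_sub _ _).trans (add_le_add (hfb _) hMb)) 2
    have hres := exp_neg_mul_integral_resample_le_of_floor hinv f (haarProbability G) (hfloor f) hgm hgB hg0
    refine le_trans (mul_le_mul_of_nonneg_left ?_ (Real.exp_pos _).le) hres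
    calc PlaquetteLowerBound.charVariance ρ = ∫ _U, PlaquetteLowerBound.charVariance ρ ∂μ := by
          rw [integral_const, smul_eq_mul, probReal_univ, one_mul]
      _ ≤ _ := by
          refine integral_mono_of_nonneg (Filter.Eventually.of_forall fun U => ?_) ?_
            (Filter.Eventually.of_forall fun U => charVariance_le_integral_fibreVariance_zd ρ hρ hN (hP e he) he₀ hf hfe hstaple U)
          · exact (PlaquetteLowerBound.charVariance_pos ρ hρc (by omega)).le
          · exact integrable_of_abs_le_const
              ((hgm.comp measurable_update').stronglyMeasurable.integral_prod_right' (ν := haarProbability G))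
              fun U => abs_integral_le_of_abs_le _ fun y => hgB _
  -- Step 3: assemble
  have h3 := Finset.sum_le_sum h2
  rw [Finset.sum_const, nsmul_eq_mul] at h3
  have hexp : Real.exp (-(8 * (d - 1 : ℕ) * N * |β|)) = Real.exp (-D) * Real.exp (-D) := by
    rw [← Real.exp_add, hD]; ring_nf
  calc (F.card : ℝ) * Real.exp (-(8 * (d - 1 : ℕ) * N * |β|)) * PlaquetteLowerBound.charVariance ρ
      = (F.card : ℝ) * (Real.exp (-D) * (Real.exp (-D) * PlaquetteLowerBound.charVariance ρ)) := by rw [hexp]; ring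
    _ ≤ _ := h3
    _ ≤ _ := h1

/-- The same floor for the Mathlib variance `Var[Σ_{p∈P} Re tr ρ(U_p); μ]`. [folklore] -/
theorem card_mul_le_variance_plaquetteSum' (hρ : IsSpecialUnitaryModel ρ) (hN : 2 ≤ N) (hd : 2 ≤ d) {β : ℝ}
    {μ : Measure (LGConfig d G)} (hμ : μ ∈ ymGibbsMeasures ρ β) (F : Finset (Literature.MathematicalPhysics.QuantumLattice.ZdEdge d))
    (hF : ∀ e ∈ F, ∀ e' ∈ F, e ≠ e' → ∀ p : ZdPlaquette d, e ∈ plaquetteEdges p → e' ∉ plaquetteEdges p)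
    (P : Finset (ZdPlaquette d)) (hP : ∀ e ∈ F, plaquettesTouching {e} ⊆ P) :
    (F.card : ℝ) * Real.exp (-(8 * (d - 1 : ℕ) * N * |β|)) * PlaquetteLowerBound.charVariance ρ ≤
      Var[fun U : LGConfig d G => ∑ p ∈ P, plaquetteObs ρ p.1 p.2.1.1 p.2.1.2 U; μ] := by
  haveI := hμ.isProbabilityMeasure
  have hfm : Measurable fun U : LGConfig d G => ∑ p ∈ P, plaquetteObs ρ p.1 p.2.1.1 p.2.1.2 U :=
    (continuous_plaquetteSum_and_abs_le (d := d) ρ hρ.1 (IsSpecialUnitaryModel.mem_unitaryGroup ρ hρ) P).1.measurable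
  rw [variance_eq_integral hfm.aemeasurable]
  exact card_mul_le_variance_plaquetteSum ρ hρ hN hd hμ F hF P hP

end EnergyVariance

end Summit.Ventures.YMGap.RobustBall
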